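import Summits.BirchSwinnertonDyer.BirchSwinnertonDyer.Theorems.PrintCf2RamifiedOffTYZLevelTwoModTwo
import HarnessLib

/-!
# Route `PrintCf2`, crux stmt-BirchSwinnertonDyer-20509 `RamifiedOffTYZOfFacts` — THE `ρ`-VALVE IS A THEOREM and the
# generator side of the `(ρ(n), [α_n])` dichotomy read in `E_n(ℚ)`-currency
# (cell `bsd-print-cf2`, LEAD of 20509 g3, line `offtyz-v7`, lineage cycle 4; fact-free, Theses-free, no `def`)

HONEST FRAMING (cell `bsd-print-cf2`, run/shared/lean/pub/bsd-print-cf2/; route `PrintCf2`; crux 20509 =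
`𝔅_ram → WAllCornerFTwoRamifiedOffTYZProved`, DECIDING, OPEN AS A CLASS).  Pure `2`-descent algebra on the tree's own
objects (Tian–Yuan–Zhang's fixed curve `A = curveA : Y² = X³ + 4X`, the explicit `2`-isogeny `φ_H : A(ℍ′_n) → A₂(ℍ′_n)`,
the twist transfer `Θ_A : A_n′(ℚ) → A(K_n)⁻`, `Θ_E : E_n(ℚ) → A₂(K_n)⁻` of the W2 kernel, and the displayed data
`D : GenusPointData n` of which ONLY the field `ℍ′_n ∋ i, √−d` is used in §1–§2); nothing is asserted, no named fact
is introduced, no printed statement of TYZ §3 is assumed before §3.  The registered research stub of the line is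
C⁺ = `stub_offTYZ_levelTwoScriptLExact` (on the jump-one rank-one class `2 ∥ 𝓛(n)`; OPEN, NO PRINT, equivalent to
`BSD(E_n, 2)` there).  The previous LEAD (g2, `PrintCf2RamifiedOffTYZLevelTwoModTwo`) split the class by
`(ρ(n), [α_n])`, `[·]` the class in `V = A(ℍ′_n)/(2A(ℍ′_n) + A(ℍ′_n)_tor)`, `2^{ρ(n)} = [E_n(ℚ) : φ_n(A_n(ℚ)) + E_n[2]]`,
`α_n` a generator of the free part of `A(K_n)⁻`, and left the part `{ρ ≥ 1, [α_n] ≠ 0}` as a "valve" on which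
`BSD(E_n, 2)` would fail (`four_dvd_of_isScriptL_of_one_le_of_generator_not_twoDivisible`), "expected vacuous by a hand
Kummer computation".  THIS FILE PROVES THE VALVE SHUT and rewrites the generator side of the dichotomy in terms of the
rational generator `R` of `E_n(ℚ)` alone:

* §1 `twoDivisible_of_mem_minusPart_of_one_le_rho` (**the valve is a theorem**): for square-free `n` with
  `rank E_n(ℚ) ≤ 1`, if `ρ(n) ≥ 1` then EVERY point of `A(K_n)⁻` is `2`-divisible in `A(ℍ′_n)` modulo torsion — for
  every data `D` (only `ℍ′_n ⊇ ℚ(i, √−d : d ∣ n)` is used).  Mechanism: the index lemma `ψ_ℚ(α₀) = ±2^ρ R + t₂`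
  (`W2.stub_S1`), the intertwining `φ_A ∘ Θ_A = Θ_E ∘ ψ_ℚ` (`W2.twist_intertwine`) and the HALVING of the twisted
  rational generator `ι Θ_E(R) = φ_H(Q₁)` over `ℍ′_n` (`W2.twist_halving`: `x(R) ∈ d·ℚ^{×2}`, `d ∣ n`, is a square in
  `ℍ′_n`) give `ι Θ_A(α₀) ≡ ±2^ρ·Q₁` modulo torsion (`map_ΘA_sub_zsmul_half_isOfFinAddOrder`, any `ρ`).  Hence
  (`rhoIndex_eq_one_of_not_twoDivisible`) **`[γ] ≠ 0` for one `γ ∈ A(K_n)⁻` forces `ρ(n) = 0`**: the part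
  `{ρ ≥ 1, [α_n] ≠ 0}` of g2's dichotomy is EMPTY, unconditionally (no BSD, no GZK, no TYZ §3).
* §2 (`ρ(n) = 0`) `generator_twoDivisible_iff_half_twoDivisible`: `[α_n] = 0 ⟺ [Q₁] = 0` for ANY `φ_H`-half `Q₁` of the
  twisted rational generator — so the "visible part" `{ρ = 0, [α_n] ≠ 0}` of the jump-one class is
  `{x(R) ∈ {±1, ±n}·ℚ^{×2}` (tree `RhoIndexTorsionClasses`) `∧` the half `Q₁` of `ι Θ_E(R)` is not `2`-divisible over
  `ℍ′_n` modulo torsion`}`, a statement about `R ∈ E_n(ℚ)` and the field `ℍ′_n` only.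
* §3 (with g2's theorems, granted Thm 3.5's displayed main clause, integrality and GZK as there): the dichotomy WITHOUT a
  `ρ`-hypothesis — `levelTwo_iff_genusPoint_not_twoDivisible` (`[α_n] ≠ 0 ⟹ (C⁺ at n ⟺ [P(n)] ≠ 0)`),
  its `E_n(ℚ)`-currency form `levelTwo_iff_genusPoint_not_twoDivisible_of_half` (hypothesis `[Q₁] ≠ 0` and `ρ(n) = 0`),
  and the lower half `two_dvd_of_isScriptL_of_generator_not_twoDivisible` (`[α_n] ≠ 0 ⟹ 2 ∣ 𝓛(n)`).

What this buys the line (LEAD census, crux 20509): the jump-one rank-one class splits as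
VISIBLE = `{ρ = 0 ∧ [Q₁] ≠ 0}` (C⁺ is depth one there: lower half proved modulo the display, upper half ⟺ `[P(n)] ≠ 0`
⟺ — even weights, g2's sequel — the genus period `Z(n)` is not `2`-divisible modulo torsion) and HIDDEN =
`{[α_n] = 0}` ⊇ `{ρ = 1}` (C⁺ needs `P(n) mod 4A(ℍ′_n)`); the third part of g2's split does not exist.  In
`(1+i)`-adic language on `E(ℍ′_n)/tors ≅ A(ℍ′_n)/tors` (`φ_H ≃ [1+i]`): `R` always has depth `≥ 1` (halving), and the
visible part is `{ρ = 0 ∧ depth(R) ≤ 2}`.  Beyond-print theorem: NO (descent bookkeeping); C⁺ itself stays open.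
BSD is not proved by any of this; no class is closed by this file.

References: [cite: TianYuanZhang2017, §1 (arXiv:1411.4728 chunk p0002 L101–L110: `ρ(n)`, `φ_n`), §3.1 (p0011 L27–L36:
`A(K_n)⁻`, `α_n`; p0011 L60–L66: `ℍ′_n`), Thm. 3.5 (p0011 L94–L100), Lemma 3.16 (p0017 L105–L113: `ker φ = {0, τ(1)}`)];
[cite: SilvermanAEC2009, Prop. X.4.9 (the `2`-isogeny descent map `x mod squares`)]; [cite: Darmon2004, Thm. 3.22] (GZK,
binder `hGZK`, §3 only); tree: `TianYuanZhang2017/GenusDescent{Defs,Twist,EnSide}.lean` (W2 kernel),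
`Theorems/PrintCf2RamifiedOffTYZLevelTwoModTwo.lean` (g2), `Theorems/PrintCf2RamifiedOffTYZLevelTwoGenusPoint.lean` (g0).
-/

noncomputable section

open scoped Classical

open WeierstrassCurve WeierstrassCurve.Affine Literature.NumberTheory.EllipticCurves
  Literature.NumberTheory.EllipticCurves.Rank1Residual Summit.BirchSwinnertonDyer.Rank1Residual
  Literature.NumberTheory.EllipticCurves.TianYuanZhang2017
  Literature.NumberTheory.EllipticCurves.TianYuanZhang2017.W2

set_option autoImplicit false

namespace Summit.BirchSwinnertonDyer.PrintCf2.LevelTwoRhoValve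

/-! ## §0 Two abstract lemmas on `2`-divisibility modulo torsion -/

section Abstract

variable {G : Type*} [AddCommGroup G]

/-- `a ≡ m·b` modulo torsion and `b ∈ 2G + G_tor` give `a ∈ 2G + G_tor`. [folklore] -/
theorem twoDivisible_of_sub_zsmul {a b : G} {m : ℤ} (h : IsOfFinAddOrder (a - m • b))
    (hb : ∃ y : G, IsOfFinAddOrder (b - (2 : ℤ) • y)) : ∃ y : G, IsOfFinAddOrder (a - (2 : ℤ) • y) := by
  obtain ⟨y, hy⟩ := hb
  refine ⟨m • y, ?_⟩
  have e : a - (2 : ℤ) • (m • y) = (a - m • b) + m • (b - (2 : ℤ) • y) := by module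
  rw [e]
  exact h.add hy.zsmul

/-- `a − (ε·2^ρ)·q` of finite order with `1 ≤ ρ` gives `a ∈ 2G + G_tor`. [folklore] -/
theorem twoDivisible_of_sub_pow_zsmul {a q : G} {ε : ℤ} {ρ : ℕ} (h1 : 1 ≤ ρ)
    (h : IsOfFinAddOrder (a - (ε * 2 ^ ρ) • q)) : ∃ y : G, IsOfFinAddOrder (a - (2 : ℤ) • y) := by
  obtain ⟨j, hj⟩ : ∃ j, ρ = j + 1 := ⟨ρ - 1, by omega⟩
  refine ⟨(ε * 2 ^ j) • q, ?_⟩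
  have e : a - (2 : ℤ) • ((ε * 2 ^ j) • q) = a - (ε * 2 ^ ρ) • q := by rw [hj, pow_succ]; module
  rwa [e]

end Abstract

/-! ## §1 The valve: `ρ(n) ≥ 1` forces `A(K_n)⁻ ⊆ 2A(ℍ′_n) + A(ℍ′_n)_tor` -/

section EnSide

variable {n : ℕ}

/-- `φ_H : A(ℍ′_n) → A₂(ℍ′_n)` reflects finite order (its kernel `{0, τ(1)}` is torsion, Lemma 3.16).
[cite: TianYuanZhang2017, Lemma 3.16 (chunk p0017 L105–L113)] -/
theorem isOfFinAddOrder_of_φH (D : GenusPointData n) {X : APoint D.H} (h : IsOfFinAddOrder (φH D X)) :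
    IsOfFinAddOrder X := by
  obtain ⟨N, hN, hNX⟩ := h.exists_nsmul_eq_zero
  rw [← map_nsmul] at hNX
  rcases (φH_eq_zero_iff D _).mp hNX with h0 | h0
  · exact isOfFinAddOrder_iff_nsmul_eq_zero.mpr ⟨N, hN, h0⟩
  · refine isOfFinAddOrder_iff_nsmul_eq_zero.mpr ⟨2 * N, by omega, ?_⟩
    rw [mul_comm, mul_nsmul, h0]
    exact two_nsmul_tauOne

/-- **THE HALF RELATION.** Square-free `n`, data `D` (only `ℍ′_n` is used), the index lemma's output
`ψ_ℚ(α₀) = (ε·2^ρ)·R + t₂` with `2t₂ = 0` (`W2.stub_S1`), and ANY `Q₁ ∈ A(ℍ′_n)` with `φ_H(Q₁) = ι Θ_E(R)` (a half of the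
twisted point `R`, which exists by `W2.twist_halving`): then **`ι Θ_A(α₀) − (ε·2^ρ)·Q₁` has finite order** in `A(ℍ′_n)`
(apply `φ_H`: by the intertwining `φ_A ∘ Θ_A = Θ_E ∘ ψ_ℚ` the image is `ι Θ_E(t₂)`, killed by `2`; `φ_H` reflects
finite order). [cite: TianYuanZhang2017, §1 (chunk p0002 L101–L110) and §3.1 (p0011 L27–L36)] [cite: SilvermanAEC2009, Prop. X.4.9] -/
theorem map_ΘA_sub_zsmul_half_isOfFinAddOrder (hsq : Squarefree n) [(congruentNumberCurve n).IsElliptic]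
    (D : GenusPointData n) {ρ : ℕ} {ε : ℤ} {α₀ : (Atwo n).toAffine.Point}
    {R t₂ : (congruentNumberCurve n).toAffine.Point} (ht₂ : (2 : ℕ) • t₂ = 0)
    (hψα : ψQ n α₀ = (ε * 2 ^ ρ) • R + t₂) {Q₁ : APoint D.H}
    (hQ₁ : φH D Q₁ = Point.map (W' := curveA.twoIsogenyCodomain)
      (D.embK n (Nat.mem_divisors_self n hsq.ne_zero)) (ΘE hsq.ne_zero R)) :
    IsOfFinAddOrder (Point.map (W' := curveA) (D.embK n (Nat.mem_divisors_self n hsq.ne_zero))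
      (ΘA hsq.ne_zero α₀) - (ε * 2 ^ ρ) • Q₁) := by
  have hn : n ∈ n.divisors := Nat.mem_divisors_self n hsq.ne_zero
  set ιE := Point.map (W' := curveA.twoIsogenyCodomain) (D.embK n hn) with hιE
  -- `φ_H (ι (Θ_A α₀)) = ι (Θ_E (ψ α₀))`
  have hφι : φH D (Point.map (W' := curveA) (D.embK n hn) (ΘA hsq.ne_zero α₀)) =
      ιE (ΘE hsq.ne_zero (ψQ n α₀)) := by
    rw [φH, ← map_twoIsogenyPointsHom, twist_intertwine]
  have hφX : φH D (Point.map (W' := curveA) (D.embK n hn) (ΘA hsq.ne_zero α₀) - (ε * 2 ^ ρ) • Q₁) =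
      ιE (ΘE hsq.ne_zero t₂) := by
    rw [map_sub, map_zsmul, hφι, hQ₁, hψα, map_add, map_zsmul, map_add, map_zsmul]
    abel
  have h2 : (2 : ℕ) • φH D (Point.map (W' := curveA) (D.embK n hn) (ΘA hsq.ne_zero α₀) - (ε * 2 ^ ρ) • Q₁) = 0 := by
    rw [hφX, ← map_nsmul, ← map_nsmul, ht₂, map_zero, map_zero]
  exact isOfFinAddOrder_of_φH D (isOfFinAddOrder_iff_nsmul_eq_zero.mpr ⟨2, two_pos, h2⟩)

/-- **THE `ρ`-VALVE IS A THEOREM.** Square-free `n` with `rank E_n(ℚ) ≤ 1`; `2^ρ = [E_n(ℚ) : φ_n(A_n(ℚ)) + E_n[2]]`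
(`(rhoSubgroup n).index`) with **`ρ ≥ 1`**.  Then EVERY `γ ∈ A(K_n)⁻` is `2`-divisible in `A(ℍ′_n)` modulo torsion:
`ι γ − 2·y` has finite order for some `y ∈ A(ℍ′_n)` — for every data `D : GenusPointData n` (only the field
`ℍ′_n ∋ i, √−d` is used; no printed statement of TYZ §3, no GZK, no BSD).  Proof: `γ = Θ_A(P)`, `P ≡ k·α₀` modulo
torsion for the generator `α₀` of `A_n′(ℚ)` (`W2.stub_S0'`), `ψ_ℚ(α₀) = ±2^ρ R + t₂` (`W2.stub_S1`), and the half relation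
`ι Θ_A(α₀) ≡ ±2^ρ·Q₁` with `ρ ≥ 1`.  So the part `{ρ(n) ≥ 1, [α_n] ≠ 0}` of the `(ρ, [α_n])` dichotomy of
`PrintCf2RamifiedOffTYZLevelTwoModTwo` is EMPTY ("expected vacuous" there — now proved).
[cite: TianYuanZhang2017, §1 (chunk p0002 L101–L110) and §3.1 (p0011 L27–L36, L60–L66)] [cite: SilvermanAEC2009, Prop. X.4.9] -/
theorem twoDivisible_of_mem_minusPart_of_one_le_rho (hsq : Squarefree n) [(congruentNumberCurve n).IsElliptic]
    (hr1 : (congruentNumberCurve n).mordellWeilRank ≤ 1) (D : GenusPointData n)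
    {ρ : ℕ} (hρ : (rhoSubgroup n).index = 2 ^ ρ) (h1 : 1 ≤ ρ)
    {γ : APoint (GenusField n)} (hγ : γ ∈ minusPart n) :
    ∃ y : APoint D.H, IsOfFinAddOrder
      (Point.map (W' := curveA) (D.embK n (Nat.mem_divisors_self n hsq.ne_zero)) γ - (2 : ℤ) • y) := by
  have hn0 : n ≠ 0 := hsq.ne_zero
  have hn : n ∈ n.divisors := Nat.mem_divisors_self n hn0
  obtain ⟨R, hR⟩ := stub_S0 (n := n) hr1
  obtain ⟨α₀, hα₀⟩ := stub_S0' (n := n) hr1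
  obtain ⟨ε, -, t₂, ht₂, hψα⟩ := stub_S1 hsq (ψQ n) xSqClass_eq_one_iff_exists_ψQ hρ hR hα₀
  obtain ⟨Q₁, hQ₁⟩ := twist_halving hsq hn D R
  have key := map_ΘA_sub_zsmul_half_isOfFinAddOrder hsq D ht₂ hψα hQ₁
  -- `γ = Θ_A P`, `P ≡ k α₀`
  obtain ⟨P, rfl⟩ := exists_ΘA_eq hn0 γ hγ
  obtain ⟨k, hk⟩ := hα₀ P
  have hγk : IsOfFinAddOrder (Point.map (W' := curveA) (D.embK n hn) (ΘA hn0 P) -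
      k • Point.map (W' := curveA) (D.embK n hn) (ΘA hn0 α₀)) := by
    have h := (Point.map (W' := curveA) (D.embK n hn)).isOfFinAddOrder ((ΘA hn0).isOfFinAddOrder hk)
    rwa [map_sub, map_zsmul, map_sub, map_zsmul] at h
  exact twoDivisible_of_sub_zsmul hγk (twoDivisible_of_sub_pow_zsmul h1 key)

/-- **`[γ] ≠ 0` FORCES `ρ(n) = 0`.** Square-free `n` with `rank E_n(ℚ) ≤ 1`: if SOME `γ ∈ A(K_n)⁻` is NOT `2`-divisible in
`A(ℍ′_n)` modulo torsion (for some data `D`), then `[E_n(ℚ) : φ_n(A_n(ℚ)) + E_n[2]] = 1`, i.e. `ρ(n) = 0` (`ρ` exists by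
`W2.stub_S3`; `ρ ≥ 1` is excluded by the valve). [cite: TianYuanZhang2017, §1 (chunk p0002 L101–L110) and §3.1 (p0011 L27–L36)] -/
theorem rhoIndex_eq_one_of_not_twoDivisible (hsq : Squarefree n) [(congruentNumberCurve n).IsElliptic]
    (hr1 : (congruentNumberCurve n).mordellWeilRank ≤ 1) (D : GenusPointData n)
    {γ : APoint (GenusField n)} (hγ : γ ∈ minusPart n)
    (hγ2 : ¬ ∃ y : APoint D.H, IsOfFinAddOrder
      (Point.map (W' := curveA) (D.embK n (Nat.mem_divisors_self n hsq.ne_zero)) γ - (2 : ℤ) • y)) :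
    (rhoSubgroup n).index = 1 := by
  obtain ⟨ρ, hρ⟩ := stub_S3 hsq
  rcases Nat.eq_zero_or_pos ρ with rfl | hpos
  · simpa using hρ
  · exact absurd (twoDivisible_of_mem_minusPart_of_one_le_rho hsq hr1 D hρ hpos hγ) hγ2

/-! ## §2 `ρ(n) = 0`: `[α_n] = 0 ⟺ [Q₁] = 0` for any half `Q₁` of the twisted rational generator -/

/-- **THE GENERATOR SIDE IN `E_n(ℚ)`-CURRENCY (`ρ(n) = 0`).** Square-free `n` with `rank E_n(ℚ) ≤ 1` and
`[E_n(ℚ) : φ_n(A_n(ℚ)) + E_n[2]] = 1`; `α` a generator of the free part of `A(K_n)⁻`; `R` a generator of `E_n(ℚ)` modulo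
torsion; `Q₁ ∈ A(ℍ′_n)` ANY point with `φ_H(Q₁) = ι Θ_E(R)` (a half of the twisted rational generator; one exists by
`W2.twist_halving`).  Then **`α` is `2`-divisible in `A(ℍ′_n)` modulo torsion iff `Q₁` is**: `[α_n] = [Q₁]`-vanishing in
`V = A(ℍ′_n)/(2A(ℍ′_n) + A(ℍ′_n)_tor)` (half relation with `ρ = 0`: `ι Θ_A(α₀) ≡ ±Q₁`, and `α ≡ ±Θ_A(α₀)` modulo torsion).
[cite: TianYuanZhang2017, §1 (chunk p0002 L101–L110) and §3.1 (p0011 L27–L36)] [cite: SilvermanAEC2009, Prop. X.4.9] -/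
theorem generator_twoDivisible_iff_half_twoDivisible (hsq : Squarefree n) [(congruentNumberCurve n).IsElliptic]
    (hr1 : (congruentNumberCurve n).mordellWeilRank ≤ 1) (D : GenusPointData n)
    (hρ0 : (rhoSubgroup n).index = 1) {α : APoint (GenusField n)} (hα : GeneratesFreePart n α)
    {R : (congruentNumberCurve n).toAffine.Point} (hR : ∀ x, ∃ k : ℤ, IsOfFinAddOrder (x - k • R))
    {Q₁ : APoint D.H} (hQ₁ : φH D Q₁ = Point.map (W' := curveA.twoIsogenyCodomain)
      (D.embK n (Nat.mem_divisors_self n hsq.ne_zero)) (ΘE hsq.ne_zero R)) :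
    (∃ y : APoint D.H, IsOfFinAddOrder
      (Point.map (W' := curveA) (D.embK n (Nat.mem_divisors_self n hsq.ne_zero)) α - (2 : ℤ) • y)) ↔
      ∃ y : APoint D.H, IsOfFinAddOrder (Q₁ - (2 : ℤ) • y) := by
  have hn0 : n ≠ 0 := hsq.ne_zero
  have hn : n ∈ n.divisors := Nat.mem_divisors_self n hn0
  set ιA := Point.map (W' := curveA) (D.embK n hn) with hιA
  obtain ⟨α₀, hα₀⟩ := stub_S0' (n := n) hr1
  have hρ : (rhoSubgroup n).index = 2 ^ 0 := by simpa using hρ0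
  obtain ⟨ε, hε, t₂, ht₂, hψα⟩ := stub_S1 hsq (ψQ n) xSqClass_eq_one_iff_exists_ψQ hρ hR hα₀
  have key := map_ΘA_sub_zsmul_half_isOfFinAddOrder hsq D ht₂ hψα hQ₁
  rw [pow_zero, mul_one] at key
  have hε2 : ε * ε = 1 := by rcases hε with rfl | rfl <;> norm_num
  -- `α ≡ k Θ_A α₀` and `Θ_A α₀ ≡ m α` modulo torsion
  obtain ⟨P, hP⟩ := exists_ΘA_eq hn0 α hα.1
  obtain ⟨k, hk⟩ := hα₀ P
  have hαk : IsOfFinAddOrder (ιA α - k • ιA (ΘA hn0 α₀)) := by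
    have h := ιA.isOfFinAddOrder ((ΘA hn0).isOfFinAddOrder hk)
    rwa [map_sub, map_zsmul, hP, map_sub, map_zsmul] at h
  obtain ⟨m, hm⟩ := hα.2 (ΘA hn0 α₀) (map_conj_ΘA hn0 α₀)
  have hα₀m : IsOfFinAddOrder (ιA (ΘA hn0 α₀) - m • ιA α) := by
    have h := ιA.isOfFinAddOrder hm
    rwa [map_sub, map_zsmul] at h
  constructor
  · intro hαdiv
    -- `Q₁ = ε ιΘ_A α₀ − ε X`
    have hQ : IsOfFinAddOrder (Q₁ - ε • ιA (ΘA hn0 α₀)) := by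
      have e : Q₁ - ε • ιA (ΘA hn0 α₀) = (-ε) • (ιA (ΘA hn0 α₀) - ε • Q₁) := by
        rw [neg_smul, smul_sub, smul_smul, hε2, one_smul]; abel
      rw [e]
      exact key.zsmul
    exact twoDivisible_of_sub_zsmul hQ (twoDivisible_of_sub_zsmul hα₀m hαdiv)
  · intro hQdiv
    exact twoDivisible_of_sub_zsmul hαk (twoDivisible_of_sub_zsmul key hQdiv)

/-- **Corollary (`ρ(n) = 0`, existence form).** Under the same hypotheses, `[α_n] = 0` iff the twisted rational
generator `ι Θ_E(R)` lies in `2·φ_H(A(ℍ′_n)) + A₂(ℍ′_n)_tor` — `ι Θ_E(R) − 2·φ_H(y)` has finite order for some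
`y ∈ A(ℍ′_n)`. [cite: TianYuanZhang2017, §1 (chunk p0002 L101–L110) and §3.1 (p0011 L27–L36)] [cite: SilvermanAEC2009, Prop. X.4.9] -/
theorem generator_twoDivisible_iff_twist_mem (hsq : Squarefree n) [(congruentNumberCurve n).IsElliptic]
    (hr1 : (congruentNumberCurve n).mordellWeilRank ≤ 1) (D : GenusPointData n)
    (hρ0 : (rhoSubgroup n).index = 1) {α : APoint (GenusField n)} (hα : GeneratesFreePart n α)
    {R : (congruentNumberCurve n).toAffine.Point} (hR : ∀ x, ∃ k : ℤ, IsOfFinAddOrder (x - k • R)) :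
    (∃ y : APoint D.H, IsOfFinAddOrder
      (Point.map (W' := curveA) (D.embK n (Nat.mem_divisors_self n hsq.ne_zero)) α - (2 : ℤ) • y)) ↔
      ∃ y : APoint D.H, IsOfFinAddOrder (Point.map (W' := curveA.twoIsogenyCodomain)
        (D.embK n (Nat.mem_divisors_self n hsq.ne_zero)) (ΘE hsq.ne_zero R) - (2 : ℤ) • φH D y) := by
  have hn : n ∈ n.divisors := Nat.mem_divisors_self n hsq.ne_zero
  obtain ⟨Q₁, hQ₁⟩ := twist_halving hsq hn D R
  rw [generator_twoDivisible_iff_half_twoDivisible hsq hr1 D hρ0 hα hR hQ₁]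
  constructor
  · rintro ⟨y, hy⟩
    refine ⟨y, ?_⟩
    have h := (φH D).isOfFinAddOrder hy
    rwa [map_sub, map_zsmul, hQ₁] at h
  · rintro ⟨y, hy⟩
    refine ⟨y, isOfFinAddOrder_of_φH D ?_⟩
    rwa [map_sub, map_zsmul, hQ₁]

/-! ## §3 The dichotomy of `PrintCf2RamifiedOffTYZLevelTwoModTwo` without a `ρ`-hypothesis, and in `E_n(ℚ)`-currency -/

/-- **THE DICHOTOMY, `ρ`-FREE.** Square-free `n ≡ 5, 6, 7 (mod 8)` with `ord_{s=1} L(E_n, s) = 1`; GZK; data `D` with the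
displayed main clause of Thm 3.5 (`h35`) and integrality (`hLs`); `α` a generator of the free part of `A(K_n)⁻` that is NOT
`2`-divisible in `A(ℍ′_n)` modulo torsion.  Then `ρ(n) = 0` automatically (§1) and **C⁺ at `n` ⟺ `P(n) ∉ 2A(ℍ′_n) +
A(ℍ′_n)_tor`** (g2's `levelTwo_iff_genusPoint_not_twoDivisible_of_index_eq_one`).
[cite: TianYuanZhang2017, Thm. 3.5 (chunk p0011 L94–L100) and §3.1 (p0011 L27–L36)] [cite: Darmon2004, Thm. 3.22] -/
theorem levelTwo_iff_genusPoint_not_twoDivisible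
    (hGZK : rank_eq_analyticRank_of_analyticRank_le_one) (hsq : Squarefree n)
    (h8 : n % 8 = 5 ∨ n % 8 = 6 ∨ n % 8 = 7) (hr : (congruentNumberCurve n).analyticRank = 1)
    (D : GenusPointData n) (h35 : D.thm35Main) (hLs : D.scriptLSpec)
    {α : APoint (GenusField n)} (hα : GeneratesFreePart n α)
    (hα2 : ¬ ∃ y : APoint D.H, IsOfFinAddOrder
      (Point.map (W' := curveA) (D.embK n (Nat.mem_divisors_self n hsq.ne_zero)) α - (2 : ℤ) • y)) :
    (∀ L : ℤ, IsScriptL n L → (2 : ℤ) ∣ L ∧ ¬ (4 : ℤ) ∣ L) ↔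
      ¬ ∃ y : APoint D.H, IsOfFinAddOrder (D.P n - (2 : ℤ) • y) := by
  haveI := isElliptic_congruentNumberCurve hsq.ne_zero
  have hr1 : (congruentNumberCurve n).mordellWeilRank ≤ 1 := by rw [(hGZK _ hr.le).1]; exact hr.le
  have hρ0 := rhoIndex_eq_one_of_not_twoDivisible hsq hr1 D hα.1 hα2
  exact LevelTwoModTwo.levelTwo_iff_genusPoint_not_twoDivisible_of_index_eq_one hGZK hsq h8 hr D h35 hLs hρ0 hα hα2

/-- **THE LOWER HALF, `ρ`-FREE.** Same data; if a generator `α` of the free part of `A(K_n)⁻` is NOT `2`-divisible in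
`A(ℍ′_n)` modulo torsion then **`2 ∣ L`** for every sign choice `L` of `𝓛(n)` (g2's `2^{ρ+1} ∣ L` with `ρ = 0` forced).
[cite: TianYuanZhang2017, Thm. 3.5 (chunk p0011 L94–L100)] [cite: Darmon2004, Thm. 3.22] -/
theorem two_dvd_of_isScriptL_of_generator_not_twoDivisible
    (hGZK : rank_eq_analyticRank_of_analyticRank_le_one) (hsq : Squarefree n)
    (h8 : n % 8 = 5 ∨ n % 8 = 6 ∨ n % 8 = 7) (hr : (congruentNumberCurve n).analyticRank = 1)
    (D : GenusPointData n) (h35 : D.thm35Main) (hLs : D.scriptLSpec)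
    {α : APoint (GenusField n)} (hα : GeneratesFreePart n α)
    (hα2 : ¬ ∃ y : APoint D.H, IsOfFinAddOrder
      (Point.map (W' := curveA) (D.embK n (Nat.mem_divisors_self n hsq.ne_zero)) α - (2 : ℤ) • y))
    {L : ℤ} (hL : IsScriptL n L) : (2 : ℤ) ∣ L := by
  haveI := isElliptic_congruentNumberCurve hsq.ne_zero
  have hr1 : (congruentNumberCurve n).mordellWeilRank ≤ 1 := by rw [(hGZK _ hr.le).1]; exact hr.le
  have hρ0 := rhoIndex_eq_one_of_not_twoDivisible hsq hr1 D hα.1 hα2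
  have hρ : (rhoSubgroup n).index = 2 ^ 0 := by simpa using hρ0
  simpa using LevelTwoModTwo.two_pow_dvd_of_isScriptL_of_generator_not_twoDivisible hGZK hsq h8 hr D h35 hLs
    hρ hα hα2 hL

/-- **THE VISIBLE CRITERION IN `E_n(ℚ)`-CURRENCY.** Square-free `n ≡ 5, 6, 7 (mod 8)` with `ord_{s=1} L(E_n, s) = 1`; GZK;
data `D` with Thm 3.5's displayed main clause and integrality; `[E_n(ℚ) : φ_n(A_n(ℚ)) + E_n[2]] = 1` (`ρ(n) = 0`: every
rational point has `x ∈ {±1, ±n}·ℚ^{×2}`, tree `RhoIndexTorsionClasses`); `R` a generator of `E_n(ℚ)` modulo torsion and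
`Q₁ ∈ A(ℍ′_n)` a half of its twist (`φ_H(Q₁) = ι Θ_E(R)`) that is NOT `2`-divisible modulo torsion.  Then
**C⁺ at `n` ⟺ `P(n) ∉ 2A(ℍ′_n) + A(ℍ′_n)_tor`** — the depth-one criterion with its hypothesis read on the Mordell–Weil
generator of `E_n(ℚ)` and the field `ℍ′_n` only.
[cite: TianYuanZhang2017, Thm. 3.5 (chunk p0011 L94–L100), §1 (p0002 L101–L110)] [cite: Darmon2004, Thm. 3.22] -/
theorem levelTwo_iff_genusPoint_not_twoDivisible_of_half
    (hGZK : rank_eq_analyticRank_of_analyticRank_le_one) (hsq : Squarefree n)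
    (h8 : n % 8 = 5 ∨ n % 8 = 6 ∨ n % 8 = 7) (hr : (congruentNumberCurve n).analyticRank = 1)
    (D : GenusPointData n) (h35 : D.thm35Main) (hLs : D.scriptLSpec) (hρ0 : (rhoSubgroup n).index = 1)
    {R : (congruentNumberCurve n).toAffine.Point} (hR : ∀ x, ∃ k : ℤ, IsOfFinAddOrder (x - k • R))
    {Q₁ : APoint D.H} (hQ₁ : φH D Q₁ = Point.map (W' := curveA.twoIsogenyCodomain)
      (D.embK n (Nat.mem_divisors_self n hsq.ne_zero)) (ΘE hsq.ne_zero R))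
    (hQ2 : ¬ ∃ y : APoint D.H, IsOfFinAddOrder (Q₁ - (2 : ℤ) • y)) :
    (∀ L : ℤ, IsScriptL n L → (2 : ℤ) ∣ L ∧ ¬ (4 : ℤ) ∣ L) ↔
      ¬ ∃ y : APoint D.H, IsOfFinAddOrder (D.P n - (2 : ℤ) • y) := by
  haveI := isElliptic_congruentNumberCurve hsq.ne_zero
  have hr1 : (congruentNumberCurve n).mordellWeilRank ≤ 1 := by rw [(hGZK _ hr.le).1]; exact hr.le
  obtain ⟨α, hα, -⟩ := LevelTwo.exists_generatesFreePart_not_isOfFinAddOrder hGZK hsq hr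
  have hα2 : ¬ ∃ y : APoint D.H, IsOfFinAddOrder
      (Point.map (W' := curveA) (D.embK n (Nat.mem_divisors_self n hsq.ne_zero)) α - (2 : ℤ) • y) := by
    rw [generator_twoDivisible_iff_half_twoDivisible hsq hr1 D hρ0 hα hR hQ₁]
    exact hQ2
  exact LevelTwoModTwo.levelTwo_iff_genusPoint_not_twoDivisible_of_index_eq_one hGZK hsq h8 hr D h35 hLs hρ0 hα hα2

/-- **`BSD(E_n, 2)` no longer reads the valve.** g2's `generator_twoDivisible_of_bsdp_two_of_one_le` (on the jump-one class,
`BSD(E_n,2) ∧ ρ ≥ 1 ⟹ [α_n] = 0`) holds WITHOUT its `BSD`, Selmer, analytic-rank and TYZ hypotheses: `ρ(n) ≥ 1 ⟹ [α_n] = 0`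
for every generator (indeed every element) of `A(K_n)⁻`, granted only `rank E_n(ℚ) ≤ 1`.  Recorded in the shape of g2's
statement (GZK + `r_an = 1` supply the rank). [cite: TianYuanZhang2017, §1 (chunk p0002 L101–L110) and §3.1 (p0011 L27–L36)] [cite: Darmon2004, Thm. 3.22] -/
theorem generator_twoDivisible_of_one_le (hGZK : rank_eq_analyticRank_of_analyticRank_le_one) (hsq : Squarefree n)
    (hr : (congruentNumberCurve n).analyticRank = 1) (D : GenusPointData n)
    {ρ : ℕ} (hρ : (rhoSubgroup n).index = 2 ^ ρ) (h1 : 1 ≤ ρ)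
    {α : APoint (GenusField n)} (hα : GeneratesFreePart n α) :
    ∃ y : APoint D.H, IsOfFinAddOrder
      (Point.map (W' := curveA) (D.embK n (Nat.mem_divisors_self n hsq.ne_zero)) α - (2 : ℤ) • y) := by
  haveI := isElliptic_congruentNumberCurve hsq.ne_zero
  have hr1 : (congruentNumberCurve n).mordellWeilRank ≤ 1 := by rw [(hGZK _ hr.le).1]; exact hr.le
  exact twoDivisible_of_mem_minusPart_of_one_le_rho hsq hr1 D hρ h1 hα.1

end EnSide

end Summit.BirchSwinnertonDyer.PrintCf2.LevelTwoRhoValve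

end
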